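import Summits.BirchSwinnertonDyer.BirchSwinnertonDyer.Theorems.SylvesterTwoHeegnerIndexCoupledTelescopeProvenance
import Summits.BirchSwinnertonDyer.BirchSwinnertonDyer.Theorems.SylvesterTwoHeegnerIndexThmCDefs
import Literature.NumberTheory.EllipticCurves.HeightsProofs
import HarnessLib

/-!
# The COUPLED Cassels–Tate telescope, RESIDUE 7′ (VARIANT Q), (T-L5) PROVENANCE ON THE HALVED BOTTOM —
# `Y = 2 • (2^{M₀} x₀ + T)`, `x₀ ∉ 2E_p(K) + tors`, `2M₀ ≤ ord₂(#Ш_an(E_p)·#Ш_an(E_{3p²}))` at `p ≡ 7 (mod 9)`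

Crux `UpperOffV0HSYPlus` (stmt-BirchSwinnertonDyer-19804), skeleton VARIANT Q
`Cruxes/UpperOffV0HSYPlus/Lines/coupled_variantQ.lean` d342db51dc602551, stub `stub_residueSevenHalved` (RESIDUE 7′,
rows `p ≡ 7 (9)`; planner D736/D759, memo `Cruxes/UpperOffV0HSYPlus/MInfinityAtThree-g44.md` §5).  The stub's
provenance prefix reads `∃ M₀ x₀ T, IsOfFinAddOrder T ∧ Y^tr = (2:ℤ) • (2^{M₀} • x₀ + T) ∧ 2·M₀ ≤ ord₂(qB·qA) ∧ …`
under the TAIL's binders (a model `B` of `E_p` with `CB • B = cubeSumCurve p`, HSY's generator `P ∈ B(ℚ)` modulo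
torsion, an ANONYMOUS `Y ∈ B(K)` with the height display `qB·qA·ĥ(ιP) = 2^{−2}·ĥ(Y)`).  This file is the
`p ≡ 7 (9)` twin of (T6) `SylvesterTwoCoupledTelescope.provenance_sylvesterPair` (p ≡ 4 (9),
`…CoupledTelescopeProvenance`, whose `2`-adic bookkeeping it re-runs) and discharges that prefix GRANTED THEOREM C
(`SylvesterTwoNonneg.HSYPointTwoDivisibleSevenModNine`, the cell's #S2 / HSY Thm C — in the skeleton it is the
sorry-free `thmC_closed hF`, i.e. PRINT + (W2-b); here it is a displayed hypothesis `hC`), together with the extra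
clause the per-level (T-L5) conjunct «`2^{2κ−1} • δ x₀ ≠ 0`» consumes: `x₀ ∉ 2E_p(K) + E_p(K)_tors`.

Argument.  THEOREM C halves the anonymous `Y`: `Y = 2 • Y′ + T′` with `T′` torsion; `B(K)` has no `2`-torsion
(`two_torsion_eq_zero_of_model_of_finrank_eq_two`), so `T′ = 2 • T₄` with `T₄` torsion (`exists_two_nsmul_eq_of_isOfFinAddOrder`)
and `Y = 2 • Y″`, `Y″ := Y′ + T₄`, `ĥ(Y) = 4·ĥ(Y″)` (`canonicalHeight_nsmul_holds`); hence `Y″` stands in the display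
WITH EXPONENT `0`: `qB·qA·ĥ(ιP) = 2⁰·ĥ(Y″)`.  From there the proof is (T6)'s VERBATIM on `Y″` (Mordell model
`W′ = (CB • B)_K`, `θ = [ω]`, `P′ = ιP ∉ 2W′ + tors` by descent along the conjugation of `K/ℚ`, the `K`-line
`n • Y″ = a • P′ + b • θP′ + T₁` with `n` ODD, the split `a = 2^{M₀}a″`, `b = 2^{M₀}b″` with `a″, b″` not both even,
Bezout `u n + v 2^{M₀} = 1`, `x₀ := u • (a″P′ + b″θP′) + v • Y″`, `Y″ = 2^{M₀} x₀ + uT₁`, `x₀ ∉ 2W′ + tors`, and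
`qB·qA = (a² − ab + b²)/n²` of `2`-adic order `2M₀ + ord₂(N(a″ + b″ω)) ≥ 2M₀`) — so `M₀ = M₀(Y″) = M₀(Y) − 1` and the
UNCHANGED reading `2·M₀ ≤ ord₂(qB·qA)` is SHARP (`ord₂(qB·qA) = 2M₀(Y) − 2`, planner D702), transported to `E_p ⊗ K`
along `congrEquiv`.
* `exists_two_nsmul_eq_of_isOfFinAddOrder` — in an abelian group without `2`-torsion every torsion element is twice
  a torsion element.
* ★ `provenance_halved_sylvesterPair` — RESIDUE 7′'s provenance prefix (∃ M₀ x₀ T, three clauses, the `Y`-clause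
  HALVED) ∧ `x₀ ∉ 2E_p(K) + tors`, under the stub's binders VERBATIM (`p ≡ 7 (9)` branch), granted `hC`.
Theorems only (no definition, no named fact, no instance, no notation); CONDITIONAL on THEOREM C as displayed;
nothing asserted on 19804; no stub closed on the ledger; X12.CMAtTwo NOT proved; BSD not claimed for any curve.
Sources: Hu–Shu–Yin 2019 pp. 8, 12 (display (bsd), `i = −2`), Thm. C; Gross–Zagier 1986; memo g44 §5; (T6).
`lean search 'provenance_halved'` → nothing before this file.
-/

-- every Summits module is named `Summit.<Summit>.<Problem>…`: the duplicated component is by design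
set_option linter.dupNamespace false
set_option autoImplicit false

noncomputable section

open scoped Classical

open WeierstrassCurve WeierstrassCurve.Affine WeierstrassCurve.Affine.Point NumberField IsDedekindDomain
  Literature.NumberTheory.EllipticCurves Literature.NumberTheory.EllipticCurves.HuShuYin2019
  Literature.NumberTheory.QuadraticFields

namespace Summit.BirchSwinnertonDyer.BirchSwinnertonDyer.Theorems.SylvesterTwoCoupledTelescope

open Summit.BirchSwinnertonDyer.BirchSwinnertonDyer.Theorems.SylvesterTwoCMNormForm
open Summit.BirchSwinnertonDyer.BirchSwinnertonDyer.Theorems.SylvesterTwoCoupledDescentPrimitivity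
open Summit.BirchSwinnertonDyer.BirchSwinnertonDyer.Theses.SylvesterTwoHeegnerIndex

/-- **Odd torsion halves**: in an additive commutative group with no `2`-torsion, every element of finite order is
`2 • T₄` for some element `T₄` of finite order (its order is odd, `T₄ := (k+1) • T` for order `2k+1`). [folklore] -/
theorem exists_two_nsmul_eq_of_isOfFinAddOrder {G : Type*} [AddCommGroup G]
    (h2 : ∀ x : G, 2 • x = 0 → x = 0) {T : G} (hT : IsOfFinAddOrder T) :
    ∃ T' : G, IsOfFinAddOrder T' ∧ 2 • T' = T := by
  set n := addOrderOf T with hn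
  have hn0 : 0 < n := hT.addOrderOf_pos
  have hnT : n • T = 0 := addOrderOf_nsmul_eq_zero T
  rcases Nat.even_or_odd n with ⟨k, hk⟩ | ⟨k, hk⟩
  · exfalso
    have hk0 : k ≠ 0 := by rintro rfl; omega
    have hklt : k < n := by omega
    have hkT : k • T ≠ 0 := nsmul_ne_zero_of_lt_addOrderOf hk0 (hn ▸ hklt)
    apply hkT
    apply h2
    rw [← mul_nsmul', show 2 * k = n by omega]
    exact hnT
  · refine ⟨(k + 1) • T, hT.nsmul, ?_⟩
    rw [← mul_nsmul', show 2 * (k + 1) = n + 1 by omega, add_nsmul, hnT, one_nsmul, zero_add]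

set_option maxHeartbeats 1600000 in
/-- ★ **RESIDUE 7′, (T-L5) PROVENANCE ON THE HALVED BOTTOM, `p ≡ 7 (mod 9)`, with `x₀ ∉ 2E_p(K) + tors`** — granted
THEOREM C (`hC`).  Binders = `stub_residueSevenHalved`'s, verbatim and in order; conclusion = its provenance prefix
(`Y^tr = (2:ℤ) • (2^{M₀} • x₀ + T)`, the reading `2·M₀ ≤ ord₂(qB·qA)` sharp) ∧ the primitivity of `x₀`.
[cite: HuShuYin2019, p. 8, p. 12 display (bsd) (i = −2), Thm. C] [cite: GrossZagier1986, Thm. I.6.3] -/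
theorem provenance_halved_sylvesterPair (hC : SylvesterTwoNonneg.HSYPointTwoDivisibleSevenModNine) :
    PublishedFactsTwoPlus →
    ∀ (p : ℕ), p.Prime → p % 9 = 7 → (¬ ∃ x : ZMod p, x ^ 3 = 3) →
      ∀ (A B : WeierstrassCurve ℚ) [A.IsElliptic] [A.IsGloballyMinimal] [B.IsElliptic]
        [B.IsGloballyMinimal], (∃ C : VariableChange ℚ, C • B = HuShuYin2019.cubeSumCurve (p : ℚ)) →
        (∃ C : VariableChange ℚ, C • A = HuShuYin2019.cubeSumCurve (3 * (p : ℚ) ^ 2)) →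
        4 < Nat.card (AddCommGroup.primaryComponent B.sha 2) *
            Nat.card (AddCommGroup.primaryComponent A.sha 2) →
        ∀ (qB qA : ℚ), shaAn B = (qB : ℂ) → shaAn A = (qA : ℂ) → qB * qA ≠ 0 →
        ∀ (K : Type) [Field K] [NumberField K] (ω : K), ω ^ 2 + ω + 1 = 0 →
          Module.finrank ℚ K = 2 →
        ∀ (CB : VariableChange ℚ) (hCB : CB • B = HuShuYin2019.cubeSumCurve (p : ℚ))
          (P : B.toAffine.Point) (Y : (B.baseChange K).toAffine.Point),
          ¬ IsOfFinAddOrder (WeierstrassCurve.QuadraticDescent.incl K B P) →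
          (∀ Q : B.toAffine.Point, ∃ m : ℤ, IsOfFinAddOrder
            (WeierstrassCurve.QuadraticDescent.incl K B Q -
              m • WeierstrassCurve.QuadraticDescent.incl K B P)) →
          ((qB * qA : ℚ) : ℝ) *
              WeierstrassCurve.Affine.Point.canonicalHeight (WeierstrassCurve.QuadraticDescent.incl K B P) =
            (2 : ℝ) ^ (if p % 9 = 4 then (0 : ℤ) else -2) *
              WeierstrassCurve.Affine.Point.canonicalHeight Y →
        ∃ (M₀ : ℕ) (x₀ T : ((cubeSumCurve (p : ℚ)).baseChange K).toAffine.Point),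
        IsOfFinAddOrder T ∧
        Affine.Point.congrEquiv (congrArg (fun W : WeierstrassCurve ℚ ↦ W.baseChange K) hCB)
            (VariableChange.pointEquivBaseChange B CB K Y) = (2 : ℤ) • (((2 ^ M₀ : ℕ) : ℤ) • x₀ + T) ∧
        2 * (M₀ : ℤ) ≤ padicValRat 2 (qB * qA) ∧
        ¬ ∃ (Q T' : ((cubeSumCurve (p : ℚ)).baseChange K).toAffine.Point), IsOfFinAddOrder T' ∧ x₀ = 2 • Q + T' := by
  intro hF p hp h9 h3 A B _ _ _ _ hB hA _ qB qA hqB hqA hne K _ _ ω hω h2 CB hCB P Y hPinf hPgen hht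
  have hp2 : p ≠ 2 := by rintro rfl; norm_num at h9
  have h94 : ¬ p % 9 = 4 := by omega
  rw [if_neg h94] at hht
  -- ### rank `2` from the HSY conjunct of `PublishedFactsTwoPlus`
  obtain ⟨-, -, -, -, -, hrank, -⟩ := hF.2 p hp (Or.inr h9) h3 A B hB hA K ω hω h2
  haveI hBK : (B.baseChange K).IsElliptic := inferInstanceAs (B.map (algebraMap ℚ K)).IsElliptic
  -- ### THEOREM C halves `Y`; no `2`-torsion makes it `Y = 2 • Y″` exactly
  obtain ⟨Y', T', hT', hYe⟩ := hC p hp h9 h3 A B hB hA qB qA hqB hqA K ω hω h2 P hPinf hPgen Y hht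
  have h2torB : ∀ X : (B.baseChange K).toAffine.Point, 2 • X = 0 → X = 0 :=
    Summit.BirchSwinnertonDyer.BirchSwinnertonDyer.Theorems.SylvesterTwoFrame.two_torsion_eq_zero_of_model_of_finrank_eq_two
      K h2 hp hp2 B ⟨CB, hCB⟩
  obtain ⟨T₄, hT₄, hT₄e⟩ := exists_two_nsmul_eq_of_isOfFinAddOrder h2torB hT'
  set Y'' : (B.baseChange K).toAffine.Point := Y' + T₄ with hY''def
  have hYY'' : Y = (2 : ℤ) • Y'' := by
    rw [hYe, hY''def, smul_add, ← hT₄e, ← natCast_zsmul T₄ 2]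
    push_cast
    rfl
  have hhtY'' : ((qB * qA : ℚ) : ℝ) * canonicalHeight (WeierstrassCurve.QuadraticDescent.incl K B P) =
      (2 : ℝ) ^ (0 : ℤ) * canonicalHeight Y'' := by
    rw [hht, hYY'', canonicalHeight_zsmul_holds, zpow_zero, one_mul]
    push_cast
    rw [zpow_neg, ← mul_assoc, show ((2 : ℝ) ^ (2 : ℤ))⁻¹ * (2 : ℝ) ^ 2 = 1 by norm_num, one_mul]
  -- ### the Mordell model `W' = (CB • B)_K`, the transport `φ`, `[ω] = θ`, `P' = φ(ιP)`
  have ha1 : ((CB • B).baseChange K).a₁ = 0 := by rw [hCB]; simp [cubeSumCurve, WeierstrassCurve.baseChange]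
  have ha2 : ((CB • B).baseChange K).a₂ = 0 := by rw [hCB]; simp [cubeSumCurve, WeierstrassCurve.baseChange]
  have ha3 : ((CB • B).baseChange K).a₃ = 0 := by rw [hCB]; simp [cubeSumCurve, WeierstrassCurve.baseChange]
  have ha4 : ((CB • B).baseChange K).a₄ = 0 := by rw [hCB]; simp [cubeSumCurve, WeierstrassCurve.baseChange]
  haveI hCBK : ((CB • B).baseChange K).IsElliptic := inferInstanceAs ((CB • B).map (algebraMap ℚ K)).IsElliptic
  set φ := VariableChange.pointEquivBaseChange B CB K with hφdef
  have hφh : ∀ X, canonicalHeight (φ X) = canonicalHeight X := fun X ↦ canonicalHeight_pointEquivBaseChange B CB X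
  obtain ⟨θ, hθ⟩ := exists_omegaRot (W := (CB • B).baseChange K) hω ha1 ha2 ha3 ha4
  have hθ0 : (θ : _ → _) 0 = 0 := map_zero θ
  have hθ3 : ∀ X, θ.toAddMonoidHom (θ.toAddMonoidHom X) + θ.toAddMonoidHom X + X = 0 := fun X ↦
    omegaRot_omegaRot_add_omegaRot_add hω ha1 ha2 ha3 ha4 hθ0 hθ (omega_ne_one hω) X
  set P' := φ (WeierstrassCurve.QuadraticDescent.incl K B P) with hP'def
  have hP' : ¬IsOfFinAddOrder P' := fun h ↦ hPinf ((φ.injective.isOfFinAddOrder_iff (f := φ.toAddMonoidHom)).mp h)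
  -- ### `P' ∉ 2W' + tors` (descent along the conjugation of `K/ℚ`)
  obtain ⟨θ₀, c, hθ₀, hc⟩ := Quadratic.exists_sq_eq_algebraMap (F := ℚ) (K := K) h2
  have h2tor : ∀ X : ((CB • B).baseChange K).toAffine.Point, 2 • X = 0 → X = 0 :=
    Summit.BirchSwinnertonDyer.BirchSwinnertonDyer.Theorems.SylvesterTwoFrame.two_torsion_eq_zero_of_model_of_finrank_eq_two
      K h2 hp hp2 (CB • B) ⟨1, by rw [one_smul, hCB]⟩
  have hσσ : ∀ X, WeierstrassCurve.QuadraticDescent.conjMap (CB • B) (Quadratic.conj h2 hθ₀ hc)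
      (WeierstrassCurve.QuadraticDescent.conjMap (CB • B) (Quadratic.conj h2 hθ₀ hc) X) = X :=
    WeierstrassCurve.QuadraticDescent.conjMap_conjMap (CB • B) (Quadratic.conj_conj h2 hθ₀ hc)
  have hσP : WeierstrassCurve.QuadraticDescent.conjMap (CB • B) (Quadratic.conj h2 hθ₀ hc) P' = P' := by
    rw [hP'def, hφdef]
    show Affine.Point.map _ (VariableChange.pointEquivBaseChange B CB K _) = _
    rw [VariableChange.pointEquivBaseChange_map]
    exact congrArg (VariableChange.pointEquivBaseChange B CB K)
      (WeierstrassCurve.QuadraticDescent.conjMap_incl B (Quadratic.conj h2 hθ₀ hc) P)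
  have hP2 : ¬ ∃ (Q T : ((CB • B).baseChange K).toAffine.Point), IsOfFinAddOrder T ∧ P' = 2 • Q + T :=
    not_exists_eq_two_smul_add_torsion
      (WeierstrassCurve.QuadraticDescent.conjMap (CB • B) (Quadratic.conj h2 hθ₀ hc)) hσσ h2tor hP' hσP
      (fun X hX ↦ descends_of_generator h2 hθ₀ hc B CB hPgen X hX)
  -- ### the `K`-line with an ODD coefficient: `n • φY″ = a • P' + b • θP' + T₁`
  have hr : Module.finrank ℤ ((CB • B).baseChange K).toAffine.Point = 2 := by
    rw [← φ.toIntLinearEquiv.finrank_eq]; exact hrank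
  obtain ⟨n₀, a₀, b₀, hn₀, hY₀⟩ := exists_zsmul_eq_of_finrank_eq_two hω ha1 ha2 ha3 ha4 hθ0 hθ hr hP' (φ Y'')
  obtain ⟨n, a, b, T₁, hodd, hT₁, hYn⟩ := exists_odd_zsmul_eq θ.toAddMonoidHom hθ3 P' hP2
    n₀.natAbs le_rfl hn₀ IsOfFinAddOrder.zero hY₀
  have hn : n ≠ 0 := by rintro rfl; exact hodd ⟨0, rfl⟩
  -- the explicit quotient `qB·qA = 2^0 · (a² − ab + b²)/n²`
  have hid : ((qB * qA : ℚ) : ℝ) * canonicalHeight P' = (2 : ℝ) ^ (0 : ℤ) * canonicalHeight (φ Y'') := by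
    rw [hP'def, hφh, hφh, hhtY'']
  obtain ⟨hab, hqe⟩ := eq_two_zpow_mul_norm_div_sq_of_height_identity hω ha1 ha2 ha3 ha4 hθ0 hθ hP' hT₁ hn hYn hne hid
  -- ### split `a = 2^{M₀} a″`, `b = 2^{M₀} b″`, and Bezout `u n + v 2^{M₀} = 1`
  obtain ⟨M₀, a'', b'', rfl, rfl, hab''⟩ := exists_two_pow_split _ a b le_rfl hab
  have hcop : IsCoprime n ((2 : ℤ) ^ M₀) := by
    obtain ⟨k, hk⟩ := Int.not_even_iff_odd.mp (fun h ↦ hodd (even_iff_two_dvd.mp h))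
    exact (show IsCoprime n 2 from ⟨1, -k, by rw [hk]; ring⟩).pow_right
  obtain ⟨u, v, huv⟩ := hcop
  -- ### the bottom point
  obtain ⟨x₁, hx₁⟩ : ∃ x₁ : ((CB • B).baseChange K).toAffine.Point, x₁ = a'' • P' + b'' • θ P' := ⟨_, rfl⟩
  have hYn' : n • φ Y'' = ((2 : ℤ) ^ M₀) • x₁ + T₁ := by
    rw [hYn, hx₁, smul_add, smul_smul, smul_smul]; rfl
  obtain ⟨x₀', hx₀'⟩ : ∃ x₀' : ((CB • B).baseChange K).toAffine.Point, x₀' = u • x₁ + v • φ Y'' := ⟨_, rfl⟩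
  have hdec : φ Y'' = ((2 : ℤ) ^ M₀) • x₀' + u • T₁ := by
    rw [hx₀', smul_add, smul_comm ((2 : ℤ) ^ M₀) u x₁, smul_smul ((2 : ℤ) ^ M₀) v]
    calc φ Y'' = (u * n + v * 2 ^ M₀) • φ Y'' := by rw [huv, one_smul]
      _ = u • (n • φ Y'') + (v * 2 ^ M₀) • φ Y'' := by rw [add_smul, mul_smul]
      _ = u • (((2 : ℤ) ^ M₀) • x₁ + T₁) + (2 ^ M₀ * v) • φ Y'' := by rw [hYn', mul_comm v]
      _ = u • ((2 : ℤ) ^ M₀) • x₁ + (2 ^ M₀ * v) • φ Y'' + u • T₁ := by rw [smul_add]; abel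
  -- `x₀' ∉ 2W' + tors`: `n • x₀' = x₁ + v • T₁`
  have hnx₀ : n • x₀' = x₁ + v • T₁ := by
    rw [hx₀', smul_add, smul_comm n v (φ Y''), hYn', smul_smul, smul_add, smul_smul, ← add_assoc, ← add_smul,
      show n * u + v * 2 ^ M₀ = 1 by rw [mul_comm]; exact huv, one_smul]
  have hx₀'2 : ¬ ∃ (Q T'' : ((CB • B).baseChange K).toAffine.Point), IsOfFinAddOrder T'' ∧ x₀' = 2 • Q + T'' := by
    rintro ⟨Q, T'', hT'', hQ⟩
    apply hab''
    refine two_dvd_of_memTwo θ.toAddMonoidHom hθ3 P' hP2 ⟨n • Q, n • T'' - v • T₁, ?_, ?_⟩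
    · rw [sub_eq_add_neg]; exact hT''.zsmul.add hT₁.zsmul.neg
    · show a'' • P' + b'' • θ P' = 2 • (n • Q) + (n • T'' - v • T₁)
      rw [← hx₁]
      have e : x₁ = n • x₀' - v • T₁ := by rw [hnx₀]; abel
      rw [e, hQ, smul_add, smul_comm n (2 : ℕ) Q]
      abel
  -- ### `2 M₀ ≤ ord₂ (qB·qA)` (sharp: `ord₂(qB·qA) = 2M₀ + ord₂ N(a″ + b″ω)`, the norm odd)
  have hval : 2 * (M₀ : ℤ) ≤ padicValRat 2 (qB * qA) := by
    have hNne : (a'' ^ 2 - a'' * b'' + b'' ^ 2 : ℤ) ≠ 0 := fun h0 ↦ by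
      obtain ⟨ha, hb⟩ := norm_eq_zero_iff.mp h0
      exact hab'' ⟨ha ▸ dvd_zero 2, hb ▸ dvd_zero 2⟩
    have hN : ((2 : ℤ) ^ M₀ * a'') ^ 2 - (2 ^ M₀ * a'') * (2 ^ M₀ * b'') + (2 ^ M₀ * b'') ^ 2 =
        (2 : ℤ) ^ (2 * M₀) * (a'' ^ 2 - a'' * b'' + b'' ^ 2) := by ring
    have hNne' : (2 : ℤ) ^ (2 * M₀) * (a'' ^ 2 - a'' * b'' + b'' ^ 2) ≠ 0 :=
      mul_ne_zero (pow_ne_zero _ two_ne_zero) hNne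
    have hnQ : (n : ℚ) ≠ 0 := by exact_mod_cast hn
    have hvn : padicValRat 2 (n : ℚ) = 0 := by
      rw [padicValRat.of_int, padicValInt.eq_zero_of_not_dvd hodd]; rfl
    have hv : padicValRat 2 (qB * qA) = padicValInt 2 ((2 : ℤ) ^ (2 * M₀) * (a'' ^ 2 - a'' * b'' + b'' ^ 2)) := by
      rw [hqe, hN, zpow_zero, one_mul, padicValRat.div (by exact_mod_cast hNne') (pow_ne_zero 2 hnQ),
        padicValRat.pow, hvn, mul_zero, sub_zero, padicValRat.of_int]
    rcases (padicValInt_dvd_iff (p := 2) (2 * M₀) _).mp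
      (dvd_mul_right ((2 : ℤ) ^ (2 * M₀)) (a'' ^ 2 - a'' * b'' + b'' ^ 2)) with h0 | hle
    · exact absurd h0 hNne'
    · rw [hv]; exact_mod_cast hle
  -- ### transport to `E_p ⊗ K` along `congrEquiv`
  set ψ := Affine.Point.congrEquiv (congrArg (fun W : WeierstrassCurve ℚ ↦ W.baseChange K) hCB) with hψ
  refine ⟨M₀, ψ x₀', ψ (u • T₁), ψ.toAddMonoidHom.isOfFinAddOrder hT₁.zsmul, ?_, hval, ?_⟩
  · show ψ (φ Y) = _
    rw [hYY'', map_zsmul, map_zsmul, hdec, map_add, map_zsmul]; push_cast; rfl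
  · rintro ⟨Q, T'', hT'', hQ⟩
    refine hx₀'2 ⟨ψ.symm Q, ψ.symm T'', ψ.symm.toAddMonoidHom.isOfFinAddOrder hT'', ?_⟩
    apply ψ.injective
    rw [hQ, map_add, map_nsmul, ψ.apply_symm_apply, ψ.apply_symm_apply]

end Summit.BirchSwinnertonDyer.BirchSwinnertonDyer.Theorems.SylvesterTwoCoupledTelescope

end
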